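import Literature.NumberTheory.Automorphic.AdelicCommutativeDatumEigencharacter
import HarnessLib

/-!
# The line of a unitary automorphic character is a discrete automorphic representation; for a COMMUTATIVE datum every
# discrete automorphic representation is such a line («discrete automorphic representations of a torus = its automorphic characters»)

Topic `NumberTheory/Automorphic`; namespace `Literature.NumberTheory.Automorphic` (dot notation on ★ `AdelicGroupData.AutomorphicCharacter`,
★ `DiscreteAutomorphicRep`; grouping sub-namespace `UnitaryGroup` for the rank-one unitary groups).  Definitions WITH BODY and proved
theorems only: no named fact, no instance, no notation, no `sorry`.  Companion of ★ `AdelicCommutativeDatumEigencharacter` (§1–§2: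
the eigencharacter of an irreducible closed `W ≤ L²` of a commutative datum and its uniqueness); the pattern of ★ `TrivialAutomorphicRep`
(`ψ = 1`) and of ★ `GLOneOfHeckeCharacter.exists_cuspidalAutomorphicRepGL_of_automorphicCharacter` (`GL₁`).

* §3 **existence — the line of a character** (ANY datum, no commutativity).  A unitary automorphic character `ψ` of `G(𝔸_K)`
  (★ `AutomorphicCharacter`: continuous, `|·| = 1`, trivial on `A_G · G(K)`) descends to the bounded continuous `ψ̄` on the
  finite-volume automorphic quotient; its class `ψ.toL2 μ ∈ L²` is non-zero with `R(g) [ψ̄] = ψ(g)⁻¹ [ψ̄]` (`(R g f)(x) = f(g⁻¹ • x)`),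
  so the line `ψ.lineSubrep μ = ℂ [ψ̄]` is a closed invariant topologically irreducible subspace — the discrete automorphic
  representation **`DiscreteAutomorphicRep.ofChar ψ μ`** (one-dimensional; `R(g) = ψ(g)⁻¹` on it; `ψ ↦ ofChar ψ μ` injective).
* §4 **the dictionary** (`hcomm`; `G(𝔸_K)` locally compact second countable for the uniqueness half): the eigencharacter of
  `ofChar ψ μ` is `ψ⁻¹`; two discrete automorphic representations with the same eigencharacter are EQUAL
  (`DiscreteAutomorphicRep.eq_of_eigencharacter_eq`, multiplicity one); every discrete automorphic representation `P` is
  `ofChar (P.eigencharacter)⁻¹ μ` (`eq_ofChar`, `exists_eq_ofChar`); so `ψ ↦ ofChar ψ μ` is a BIJECTION from the unitary automorphic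
  characters onto the discrete automorphic representations (`ofChar_bijective`), and `P = ofChar ψ μ ↔ R(g)|_P = ψ(g)⁻¹`
  (`eq_ofChar_iff`) [Gelbart1975, §2.A; DeitmarEchterhoff2014, Example 6.1.10].
* §5 the read-backs for the rank-one unitary groups `cmDatum L 1 H` (the anisotropic torus `U(1)_{L/L⁺}`, [Rogawski1990, §11.1]) and
  for the tree's generic spelling `UnitaryGroup.adelicGroupData L⁺ L c 1 H` (definitionally the same datum, ★ `adelicGroupData_eq_cmDatum`).

Consumers (cell `hodgecm-mathlib`, crux H413, line LH7 (γ′) «the `U(1)` line»; the `N = 2` endoscopic side `U(1) × U(1)`): an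
occurring character family of `U(Φ₁)` is read off ONE automorphic character of `U(Φ₁)(𝔸)`, to which the rigidity ★
`torusCharacter_eq_of_torusLocalComponent_eq_of_not_mem` applies.  HC_CM is proved only modulo the printed citations until rung 0
closes; this file proves no printed citation of that programme.

## References
* [Gelbart1975] S. Gelbart, *Automorphic forms on adele groups*, Ann. of Math. Stud. 83 (1975), §2.A; Thm. 10.10 (proof, p. 158).
* [DeitmarEchterhoff2014] A. Deitmar, S. Echterhoff, *Principles of Harmonic Analysis*, 2nd ed. (2014), Example 6.1.10.
* [Rogawski1990] J. Rogawski, *Automorphic representations of unitary groups in three variables*, Ann. of Math. Stud. 123 (1990),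
  §4.6 Prop. 4.6.1, §11.1 (the endoscopic tori).
-/

noncomputable section

open MeasureTheory NumberField
open scoped InnerProductSpace

namespace Literature.NumberTheory.Automorphic

universe u

/-! ## §3 The line of a unitary automorphic character is a discrete automorphic representation -/

namespace AdelicGroupData.AutomorphicCharacter

variable {K : Type} [Field K] [NumberField K] {𝒢 : AdelicGroupData.{u} K} (ψ : 𝒢.AutomorphicCharacter)
  (μ : Measure 𝒢.automorphicQuotient) [𝒢.IsAutomorphicMeasure μ]

/-- `ψ̄ ∈ ℒ²(X, μ)`: bounded by `1` on a finite measure space. [cite: Gelbart1975, §2.A] -/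
theorem memLp_quotientFun : MemLp ψ.quotientFun 2 μ :=
  MemLp.of_bound (ψ.aestronglyMeasurable_quotientFun μ) 1 (Filter.Eventually.of_forall fun x => (ψ.norm_quotientFun x).le)

/-- **The `L²` class `[ψ̄]` of a unitary automorphic character** on the automorphic quotient. [cite: Gelbart1975, §2.A] -/
def toL2 : 𝒢.L2 μ := (ψ.memLp_quotientFun μ).toLp ψ.quotientFun

/-- `[ψ̄] = ψ̄` almost everywhere. [cite: Gelbart1975, §2.A] -/
theorem coeFn_toL2 : (ψ.toL2 μ : 𝒢.automorphicQuotient → ℂ) =ᵐ[μ] ψ.quotientFun := MemLp.coeFn_toLp _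

/-- `[ψ̄] ≠ 0`: `|ψ̄| = 1` everywhere and `μ ≠ 0`. [cite: Gelbart1975, §2.A] -/
theorem toL2_ne_zero : ψ.toL2 μ ≠ 0 := by
  intro h0
  have hae : ψ.quotientFun =ᵐ[μ] (0 : 𝒢.automorphicQuotient → ℂ) := by
    rw [toL2, ← MemLp.toLp_zero (MemLp.zero' (p := 2) (μ := μ))] at h0
    exact (MemLp.toLp_eq_toLp_iff (ψ.memLp_quotientFun μ) _).1 h0
  have hfalse : ∀ᵐ x ∂μ, False := hae.mono fun x hx => ψ.quotientFun_ne_zero x hx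
  have hμ0 : μ = 0 := Filter.eventually_false_iff_eq_bot.1 hfalse |> ae_eq_bot.1
  exact isOpen_univ.measure_ne_zero μ ⟨𝒢.toAutomorphicQuotient 1, trivial⟩ (by rw [hμ0]; rfl)

/-- **The eigen-relation `R(g) [ψ̄] = ψ(g)⁻¹ [ψ̄]`** (`ψ̄(g⁻¹ x) = ψ(g)⁻¹ ψ̄(x)`). [cite: Gelbart1975, §2.A] -/
theorem rightRegular_toL2 (g : 𝒢.Adelic) : 𝒢.rightRegular μ g (ψ.toL2 μ) = ((ψ g : ℂˣ) : ℂ)⁻¹ • ψ.toL2 μ := by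
  refine Lp.ext ?_
  have h1 := 𝒢.rightRegular_apply_coeFn μ g (ψ.toL2 μ)
  have h2 : (fun x => (ψ.toL2 μ : 𝒢.automorphicQuotient → ℂ) (g⁻¹ • x)) =ᵐ[μ] fun x => ψ.quotientFun (g⁻¹ • x) :=
    (measurePreserving_smul g⁻¹ μ).quasiMeasurePreserving.ae_eq_comp (ψ.coeFn_toL2 μ)
  have h3 := Lp.coeFn_smul (((ψ g : ℂˣ) : ℂ)⁻¹) (ψ.toL2 μ)
  filter_upwards [h1, h2, h3, ψ.coeFn_toL2 μ] with x h1 h2 h3 h4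
  rw [h1, h2, h3, Pi.smul_apply, h4, smul_eq_mul, ψ.quotientFun_smul, map_inv, Units.val_inv_eq_inv_val]

/-- **The line `ℂ [ψ̄] ≤ L²(G(𝔸_K) ⧸ A_G G(K), μ)`** of a unitary automorphic character: a closed (finite-dimensional) subspace,
invariant under the regular representation (`R(g) [ψ̄] = ψ(g)⁻¹ [ψ̄]`). [cite: Gelbart1975, §2.A] -/
def lineSubrep : ContRepresentation.ClosedSubrep (𝒢.rightRegular μ) where
  toSubmodule := ℂ ∙ ψ.toL2 μ
  apply_mem_toSubmodule g v hv := by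
    change v ∈ ℂ ∙ ψ.toL2 μ at hv
    change (𝒢.rightRegular μ g) v ∈ ℂ ∙ ψ.toL2 μ
    rw [Submodule.mem_span_singleton] at hv ⊢
    obtain ⟨a, rfl⟩ := hv
    exact ⟨a * ((ψ g : ℂˣ) : ℂ)⁻¹, by rw [map_smul, rightRegular_toL2, smul_smul]⟩
  isClosed' := (ℂ ∙ ψ.toL2 μ).closed_of_finiteDimensional

/-- The underlying submodule of the line is `ℂ [ψ̄]` (definitional). [cite: Gelbart1975, §2.A] -/
@[simp] theorem lineSubrep_toSubmodule : (ψ.lineSubrep μ).toSubmodule = ℂ ∙ ψ.toL2 μ := rfl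

/-- Membership in the line: `v = a · [ψ̄]`. [cite: Gelbart1975, §2.A] -/
theorem mem_lineSubrep_iff (v : 𝒢.L2 μ) : v ∈ ψ.lineSubrep μ ↔ ∃ a : ℂ, a • ψ.toL2 μ = v := Submodule.mem_span_singleton

/-- `[ψ̄]` lies on its line. [cite: Gelbart1975, §2.A] -/
theorem toL2_mem_lineSubrep : ψ.toL2 μ ∈ ψ.lineSubrep μ := Submodule.mem_span_singleton_self _

/-- The line is one-dimensional. [cite: Gelbart1975, §2.A] -/
theorem finrank_lineSubrep : Module.finrank ℂ (ψ.lineSubrep μ).toSubmodule = 1 := finrank_span_singleton (ψ.toL2_ne_zero μ)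

/-- `G(𝔸_K)` acts on the line by the character `ψ⁻¹`: `R(g) v = ψ(g)⁻¹ v`. [cite: Gelbart1975, §2.A] -/
theorem lineSubrep_toContRep_apply (g : 𝒢.Adelic) (v : (ψ.lineSubrep μ).toSubmodule) :
    (ψ.lineSubrep μ).toContRep g v = ((ψ g : ℂˣ) : ℂ)⁻¹ • v := by
  apply Subtype.ext
  rw [ContRepresentation.ClosedSubrep.coe_toContRep_apply]
  obtain ⟨a, ha⟩ := (ψ.mem_lineSubrep_iff μ (v : 𝒢.L2 μ)).1 v.2
  change 𝒢.rightRegular μ g (v : 𝒢.L2 μ) = ((ψ g : ℂˣ) : ℂ)⁻¹ • (v : 𝒢.L2 μ)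
  rw [← ha, map_smul, rightRegular_toL2, smul_comm]

/-- **A line is topologically irreducible**: the only closed invariant subspaces of `ℂ [ψ̄]` are `0` and itself.
[cite: Gelbart1975, §2.A] -/
theorem isTopIrreducible_lineSubrep : (ψ.lineSubrep μ).toContRep.IsTopIrreducible := by
  rw [ContRepresentation.isTopIrreducible_iff]
  haveI : IsSimpleModule ℂ (ψ.lineSubrep μ).toSubmodule := isSimpleModule_iff_finrank_eq_one.mpr (ψ.finrank_lineSubrep μ)
  refine ⟨IsSimpleModule.nontrivial ℂ (ψ.lineSubrep μ).toSubmodule, fun W => ?_⟩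
  rcases IsSimpleOrder.eq_bot_or_eq_top W.toSubmodule with h | h
  · left
    exact ContRepresentation.ClosedSubrep.ext fun v => by
      rw [← ContRepresentation.ClosedSubrep.mem_toSubmodule, h, ContRepresentation.ClosedSubrep.mem_bot, Submodule.mem_bot]
  · right
    exact ContRepresentation.ClosedSubrep.ext fun v => by
      rw [← ContRepresentation.ClosedSubrep.mem_toSubmodule, h]
      exact ⟨fun _ => ContRepresentation.ClosedSubrep.mem_top v, fun _ => Submodule.mem_top⟩

/-- The line of a character lies in the discrete spectrum `L²_disc`. [cite: Gelbart1975, §2.A] -/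
theorem lineSubrep_le_discreteSpectrum : ψ.lineSubrep μ ≤ 𝒢.discreteSpectrum μ :=
  ContRepresentation.le_discretePart (ψ.isTopIrreducible_lineSubrep μ)

/-- Two characters with the same line are equal: the line remembers `R(g) = ψ(g)⁻¹`. [cite: Gelbart1975, §2.A] -/
theorem lineSubrep_injective {ψ ψ' : 𝒢.AutomorphicCharacter} (h : ψ.lineSubrep μ = ψ'.lineSubrep μ) : ψ = ψ' := by
  refine DFunLike.ext _ _ fun g => ?_
  have hmem : ψ.toL2 μ ∈ ψ'.lineSubrep μ := h ▸ ψ.toL2_mem_lineSubrep μ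
  have h1 := congrArg Subtype.val (ψ'.lineSubrep_toContRep_apply μ g ⟨ψ.toL2 μ, hmem⟩)
  rw [ContRepresentation.ClosedSubrep.coe_toContRep_apply] at h1
  change 𝒢.rightRegular μ g (ψ.toL2 μ) = ((ψ' g : ℂˣ) : ℂ)⁻¹ • ψ.toL2 μ at h1
  rw [ψ.rightRegular_toL2 μ g] at h1
  have h2 : ((ψ g : ℂˣ) : ℂ)⁻¹ = ((ψ' g : ℂˣ) : ℂ)⁻¹ := smul_left_injective ℂ (ψ.toL2_ne_zero μ) h1
  exact Units.ext (inv_injective h2)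

end AdelicGroupData.AutomorphicCharacter

namespace DiscreteAutomorphicRep

variable {K : Type} [Field K] [NumberField K] {𝒢 : AdelicGroupData.{u} K} (ψ : 𝒢.AutomorphicCharacter)
  (μ : Measure 𝒢.automorphicQuotient) [𝒢.IsAutomorphicMeasure μ]

/-- **The line of a unitary automorphic character is a discrete automorphic representation**: `ℂ [ψ̄]` is a topologically
irreducible closed `G(𝔸_K)`-invariant subspace of `L²(G(𝔸_K) ⧸ A_G G(K), μ)`, for every datum and every automorphic measure
(`ψ = 1`: ★ `DiscreteAutomorphicRep.trivial`). [cite: Gelbart1975, §2.A] -/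
def ofChar : DiscreteAutomorphicRep 𝒢 μ where
  space := ψ.lineSubrep μ
  irreducible := ψ.isTopIrreducible_lineSubrep μ

/-- The space of `ofChar ψ μ` is the line `ℂ [ψ̄]` (definitional). [cite: Gelbart1975, §2.A] -/
@[simp] theorem ofChar_space : (ofChar ψ μ).space = ψ.lineSubrep μ := rfl

/-- `ofChar ψ μ` is one-dimensional (an automorphic character). [cite: Gelbart1975, §2.A] -/
theorem isOneDimensional_ofChar : (ofChar ψ μ).IsOneDimensional := ψ.finrank_lineSubrep μ

/-- `[ψ̄] ∈ ofChar ψ μ`. [cite: Gelbart1975, §2.A] -/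
theorem toL2_mem_ofChar : ψ.toL2 μ ∈ (ofChar ψ μ).space := ψ.toL2_mem_lineSubrep μ

/-- `G(𝔸_K)` acts on `ofChar ψ μ` by `ψ⁻¹`. [cite: Gelbart1975, §2.A] -/
theorem ofChar_toContRep_apply (g : 𝒢.Adelic) (v : (ofChar ψ μ).space.toSubmodule) :
    (ofChar ψ μ).space.toContRep g v = ((ψ g : ℂˣ) : ℂ)⁻¹ • v :=
  ψ.lineSubrep_toContRep_apply μ g v

/-- `ψ ↦ ofChar ψ μ` is injective (no commutativity needed). [cite: Gelbart1975, §2.A] -/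
theorem ofChar_injective : Function.Injective fun ψ : 𝒢.AutomorphicCharacter => ofChar ψ μ := fun _ _ h =>
  AdelicGroupData.AutomorphicCharacter.lineSubrep_injective μ (congrArg DiscreteAutomorphicRep.space h)

/-! ## §4 The dictionary for a commutative datum: `P ↦ eigencharacter P`, `ψ ↦ ofChar ψ⁻¹` -/

/-- Two discrete automorphic representations with the same space are equal (the other field is a proposition); private copy of ★
`DiscreteAutomorphicRep.ext'` of `JacquetLanglandsPartsProofs` (not imported here). [cite: Gelbart1975, §2.A] -/
private theorem eq_of_space_eq {P P' : DiscreteAutomorphicRep 𝒢 μ} (h : P.space = P'.space) : P = P' := by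
  cases P
  cases P'
  cases h
  rfl

/-- **The eigencharacter of a discrete automorphic representation of a commutative datum** (`R(g)|_P = P.eigencharacter g`;
§1 for `W := P.space`). [cite: Gelbart1975, §2.A] [cite: DeitmarEchterhoff2014, Example 6.1.10] -/
def eigencharacter (hcomm : ∀ g h : 𝒢.Adelic, g * h = h * g)
    (P : DiscreteAutomorphicRep 𝒢 μ) : 𝒢.AutomorphicCharacter := 𝒢.eigencharacter μ hcomm P.irreducible

/-- `R(g) f = P.eigencharacter(g) • f` on `P`. [cite: DeitmarEchterhoff2014, Example 6.1.10] -/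
theorem toContRep_apply_eq_eigencharacter_smul (hcomm : ∀ g h : 𝒢.Adelic, g * h = h * g)
    (P : DiscreteAutomorphicRep 𝒢 μ) (g : 𝒢.Adelic) (f : P.space.toSubmodule) :
    P.space.toContRep g f = ((P.eigencharacter μ hcomm g : ℂˣ) : ℂ) • f :=
  𝒢.toContRep_apply_eq_eigencharacter_smul μ hcomm P.irreducible g f

/-- **The eigencharacter of the line of `ψ` is `ψ⁻¹`** (`R(g) [ψ̄] = ψ(g)⁻¹ [ψ̄]`). [cite: Gelbart1975, §2.A] -/
theorem eigencharacter_ofChar (hcomm : ∀ g h : 𝒢.Adelic, g * h = h * g) : (ofChar ψ μ).eigencharacter μ hcomm = ψ⁻¹ := by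
  refine DFunLike.ext _ _ fun g => Units.ext ?_
  have h1 := (ofChar ψ μ).toContRep_apply_eq_eigencharacter_smul μ hcomm g ⟨ψ.toL2 μ, toL2_mem_ofChar ψ μ⟩
  rw [ofChar_toContRep_apply] at h1
  have h2 := (smul_left_injective ℂ (show (⟨ψ.toL2 μ, toL2_mem_ofChar ψ μ⟩ : (ofChar ψ μ).space.toSubmodule) ≠ 0 from
    fun h0 => ψ.toL2_ne_zero μ (congrArg Subtype.val h0)) h1).symm
  rw [AdelicGroupData.AutomorphicCharacter.coe_inv_apply]
  exact h2

section Dictionary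

variable [LocallyCompactSpace 𝒢.Adelic] [SecondCountableTopology 𝒢.Adelic]

/-- **A discrete automorphic representation of a commutative datum is determined by its eigencharacter** (multiplicity one,
§2). [cite: Gelbart1975, Thm. 10.10 (proof, p. 158)] -/
theorem eq_of_eigencharacter_eq (hcomm : ∀ g h : 𝒢.Adelic, g * h = h * g)
    {P P' : DiscreteAutomorphicRep 𝒢 μ} (h : P.eigencharacter μ hcomm = P'.eigencharacter μ hcomm) :
    P = P' :=
  eq_of_space_eq μ (𝒢.closedSubrep_eq_of_eigencharacter_eq μ hcomm P.irreducible P'.irreducible h)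

/-- **Every discrete automorphic representation of a commutative datum is the line of a character**, namely of the inverse of
its eigencharacter: `P = ofChar (P.eigencharacter)⁻¹`. [cite: Gelbart1975, §2.A] [cite: DeitmarEchterhoff2014, Example 6.1.10] -/
theorem eq_ofChar (hcomm : ∀ g h : 𝒢.Adelic, g * h = h * g) (P : DiscreteAutomorphicRep 𝒢 μ) : P = ofChar (P.eigencharacter μ hcomm)⁻¹ μ :=
  eq_of_eigencharacter_eq μ hcomm (by rw [eigencharacter_ofChar, AdelicGroupData.AutomorphicCharacter.inv_inv])

/-- Hence every discrete automorphic representation of a commutative datum is `ofChar ψ` for a (unique, `ofChar_injective`)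
unitary automorphic character `ψ`. [cite: Gelbart1975, §2.A] [cite: DeitmarEchterhoff2014, Example 6.1.10] -/
theorem exists_eq_ofChar (hcomm : ∀ g h : 𝒢.Adelic, g * h = h * g) (P : DiscreteAutomorphicRep 𝒢 μ) : ∃ ψ : 𝒢.AutomorphicCharacter, P = ofChar ψ μ :=
  ⟨_, P.eq_ofChar μ hcomm⟩

/-- **The dictionary**: for a commutative datum, `ψ ↦ ofChar ψ μ` is a BIJECTION from the unitary automorphic characters of
`G(𝔸_K)` onto the discrete automorphic representations in `L²(G(𝔸_K) ⧸ A_G G(K), μ)`. [cite: Gelbart1975, §2.A]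
[cite: DeitmarEchterhoff2014, Example 6.1.10] -/
theorem ofChar_bijective (hcomm : ∀ g h : 𝒢.Adelic, g * h = h * g) : Function.Bijective fun ψ : 𝒢.AutomorphicCharacter => ofChar ψ μ :=
  ⟨ofChar_injective μ, fun P => ⟨_, (P.eq_ofChar μ hcomm).symm⟩⟩

/-- On `P`, `R(g) f = ψ(g)⁻¹ f` for THE character `ψ` with `P = ofChar ψ μ`; conversely that relation on one non-zero vector pins `ψ`.
[cite: Gelbart1975, §2.A] -/
theorem eq_ofChar_iff (hcomm : ∀ g h : 𝒢.Adelic, g * h = h * g) (P : DiscreteAutomorphicRep 𝒢 μ) (ψ : 𝒢.AutomorphicCharacter) :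
    P = ofChar ψ μ ↔ ∀ (g : 𝒢.Adelic) (f : P.space.toSubmodule), P.space.toContRep g f = ((ψ g : ℂˣ) : ℂ)⁻¹ • f := by
  constructor
  · rintro rfl g f
    exact ofChar_toContRep_apply ψ μ g f
  · intro h
    rw [P.eq_ofChar μ hcomm]
    congr 1
    refine DFunLike.ext _ _ fun g => Units.ext ?_
    obtain ⟨f, hf⟩ := 𝒢.exists_ne_zero_of_isTopIrreducible μ P.irreducible
    have h1 := P.toContRep_apply_eq_eigencharacter_smul μ hcomm g f
    rw [h g f] at h1
    have h2 : ((P.eigencharacter μ hcomm g : ℂˣ) : ℂ) = ((ψ g : ℂˣ) : ℂ)⁻¹ := (smul_left_injective ℂ hf h1).symm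
    rw [AdelicGroupData.AutomorphicCharacter.coe_inv_apply, h2, inv_inv]

end Dictionary

end DiscreteAutomorphicRep

/-! ## §5 The rank-one unitary groups `U(H)`, `H ∈ M₁(L)`: discrete automorphic representations = automorphic characters -/

namespace UnitaryGroup

variable (L : Type) [Field L] [NumberField L] [IsCMField L] (H : Matrix (Fin 1) (Fin 1) L)
  (μ : Measure (cmDatum L 1 H).automorphicQuotient) [(cmDatum L 1 H).IsAutomorphicMeasure μ]

/-- **Every discrete automorphic representation of `U(H)`, `H ∈ M₁(L)`, is the line of a unitary automorphic character of
`U(H)(𝔸_{L⁺})`** (the anisotropic torus `U(1)_{L/L⁺}`; `U(H)(𝔸_{L⁺})` is commutative, ★ `cmDatum_one_mul_comm`).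
[cite: Gelbart1975, §2.A] [cite: Rogawski1990, §11.1] -/
theorem exists_eq_ofChar_cmDatum_one (P : DiscreteAutomorphicRep (cmDatum L 1 H) μ) :
    ∃ ψ : (cmDatum L 1 H).AutomorphicCharacter, P = DiscreteAutomorphicRep.ofChar ψ μ :=
  P.exists_eq_ofChar μ (cmDatum_one_mul_comm L H)

/-- **A discrete automorphic representation of `U(H)`, `H ∈ M₁(L)`, is determined by its eigencharacter.**
[cite: Gelbart1975, Thm. 10.10 (proof, p. 158)] [cite: Rogawski1990, §11.1] -/
theorem eq_of_eigencharacter_eq_cmDatum_one {P P' : DiscreteAutomorphicRep (cmDatum L 1 H) μ}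
    (h : P.eigencharacter μ (cmDatum_one_mul_comm L H) = P'.eigencharacter μ (cmDatum_one_mul_comm L H)) : P = P' :=
  DiscreteAutomorphicRep.eq_of_eigencharacter_eq μ (cmDatum_one_mul_comm L H) h

/-- **The dictionary for `U(H)`, `H ∈ M₁(L)`**: `ψ ↦ ofChar ψ μ` is a bijection from the unitary automorphic characters of
`U(H)(𝔸_{L⁺})` onto the discrete automorphic representations in `L²(U(H)(L⁺) \ U(H)(𝔸_{L⁺}), μ)`.
[cite: Gelbart1975, §2.A] [cite: Rogawski1990, §11.1] -/
theorem ofChar_bijective_cmDatum_one :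
    Function.Bijective fun ψ : (cmDatum L 1 H).AutomorphicCharacter => DiscreteAutomorphicRep.ofChar ψ μ :=
  DiscreteAutomorphicRep.ofChar_bijective μ (cmDatum_one_mul_comm L H)

/-- The same dictionary in the spelling of the tree's generic datum `UnitaryGroup.adelicGroupData L⁺ L c 1 H` (definitionally
`cmDatum L 1 H`, ★ `adelicGroupData_eq_cmDatum`). [cite: Gelbart1975, §2.A] [cite: Rogawski1990, §11.1] -/
theorem ofChar_bijective_adelicGroupData_one
    (μ : Measure (adelicGroupData ↥(maximalRealSubfield L) L (IsCMField.complexConj L) 1 H).automorphicQuotient)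
    [(adelicGroupData ↥(maximalRealSubfield L) L (IsCMField.complexConj L) 1 H).IsAutomorphicMeasure μ] :
    Function.Bijective fun ψ : (adelicGroupData ↥(maximalRealSubfield L) L (IsCMField.complexConj L) 1 H).AutomorphicCharacter =>
      DiscreteAutomorphicRep.ofChar ψ μ := by
  haveI : LocallyCompactSpace (adelicGroupData ↥(maximalRealSubfield L) L (IsCMField.complexConj L) 1 H).Adelic :=
    locallyCompactSpace_cmDatum_Adelic L 1 H
  haveI : SecondCountableTopology (adelicGroupData ↥(maximalRealSubfield L) L (IsCMField.complexConj L) 1 H).Adelic :=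
    secondCountableTopology_cmDatum_Adelic L 1 H
  exact DiscreteAutomorphicRep.ofChar_bijective μ (adelicGroupData_one_mul_comm L H)

/-- Every discrete automorphic representation of the generic rank-one unitary datum is the line of a character, and
`R(g) = ψ(g)⁻¹` on it pins `ψ`. [cite: Gelbart1975, §2.A] [cite: Rogawski1990, §11.1] -/
theorem exists_eq_ofChar_adelicGroupData_one
    (μ : Measure (adelicGroupData ↥(maximalRealSubfield L) L (IsCMField.complexConj L) 1 H).automorphicQuotient)
    [(adelicGroupData ↥(maximalRealSubfield L) L (IsCMField.complexConj L) 1 H).IsAutomorphicMeasure μ]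
    (P : DiscreteAutomorphicRep (adelicGroupData ↥(maximalRealSubfield L) L (IsCMField.complexConj L) 1 H) μ) :
    ∃ ψ : (adelicGroupData ↥(maximalRealSubfield L) L (IsCMField.complexConj L) 1 H).AutomorphicCharacter,
      P = DiscreteAutomorphicRep.ofChar ψ μ ∧
        ∀ (g : (adelicGroupData ↥(maximalRealSubfield L) L (IsCMField.complexConj L) 1 H).Adelic) (f : P.space.toSubmodule),
          P.space.toContRep g f = ((ψ g : ℂˣ) : ℂ)⁻¹ • f := by
  haveI : LocallyCompactSpace (adelicGroupData ↥(maximalRealSubfield L) L (IsCMField.complexConj L) 1 H).Adelic :=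
    locallyCompactSpace_cmDatum_Adelic L 1 H
  haveI : SecondCountableTopology (adelicGroupData ↥(maximalRealSubfield L) L (IsCMField.complexConj L) 1 H).Adelic :=
    secondCountableTopology_cmDatum_Adelic L 1 H
  obtain ⟨ψ, hψ⟩ := P.exists_eq_ofChar μ (adelicGroupData_one_mul_comm L H)
  exact ⟨ψ, hψ, (P.eq_ofChar_iff μ (adelicGroupData_one_mul_comm L H) ψ).1 hψ⟩

end UnitaryGroup

end Literature.NumberTheory.Automorphic

end
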